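import Literature.IUT.LogVolume.PrincipalArithmeticDivisorsSpan
import HarnessLib

/-!
# Rigidity of the product formula: a linear form on `ADiv_ℝ(F)` that vanishes on the principal
# divisors is a multiple of the degree; hence product-formula EXPONENTS are constant

Classical algebraic number theory (the uniqueness half of the Artin–Whaples product-formula
axiomatics, here for number fields): if real exponents `γ_v`, one per place `v ∈ 𝕍(F)`, satisfy the
re-weighted product formula `∏_v ‖f‖_v^{γ_v} = 1` for every `f ∈ F^×` (standard normalized absolute
values, `‖f‖_v = |σ_v f|^{[F_v:ℝ]}` at `v | ∞`, `‖f‖_v = q_v^{-ord_v f}` at `v ∤ ∞`), then `v ↦ γ_v` is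
CONSTANT. Equivalently (the form proved first): an `ℝ`-linear form `φ : ADiv_ℝ(F) → ℝ` with
`φ(ADiv(f)) = 0` for all `f ∈ F^×` is `φ = φ(e)·deg_F` for any `e` with `deg_F(e) = 1`.

PROOF ROUTE (kernel): the tree's `span_APrc_eq_ker_degF` ([FrdI] Thm. 6.4 (i), proof p. 115:
"the image of `Φ^birat(L)` … is equal to the set of elements of finite support with arithmetic degree
`0` — a consequence of the well-known Dirichlet unit theorem"; the nonarchimedean part by the
finiteness of the class group) gives `Ker(deg_F) = span_ℝ APrc(F) ⊆ Ker(φ)`, and `deg_F` is onto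
(`degF_surjective`), so `φ` factors through `deg_F`; evaluating on the one-place divisors `1·v`
(`deg_F(1·v) = deg_F(v) > 0`, `degWeight_pos`) turns `φ_γ = c·deg_F` into `γ_v = c`.
[cite: MochizukiFrdI2008, Thm. 6.4 (i) p.115]

CONTEXT (located, not relied on): the same statement is printed, with the same two classical inputs
(Dirichlet's unit theorem; finiteness of the class number), as Thm. 3.1 "Rigidity of product-formula
weights" / Cor. 3.3 of L. Geiger, *Repairing the ATS Chain? A Rigidity Theorem for Product-Formula
Weights …* (Zenodo 10.5281/zenodo.21952487, v0.2, 15 Aug 2026; unrefereed) and as Lemma 1 of his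
*Global Normalization in Joshi's Arithmetic Teichmüller Theory* (10.5281/zenodo.21924254, v1.1); the
`F = ℚ` case is the abc-iut cell's `Summit.ABC.IUTFork.Repair.CandJoshi33.PF_forces_constant`
(interface-free, «TODO(general form)» in that file's docstring) — this file is that general form, in
`Literature`, over Mathlib number fields. Nothing here concerns or takes a side on the disputed corpus;
no hypothesis-shaped `def … : Prop` is introduced (D-0026: two proved theorems, no new fact).
-/

noncomputable section

namespace Literature.IUT.LogVolume

open NumberField IsDedekindDomain

variable {F : Type*} [Field F] [NumberField F]

/-- **Rigidity, linear-form version.** An `ℝ`-linear form on `ADiv_ℝ(F)` that kills every principal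
divisor `ADiv(f)`, `f ∈ F^×`, is a real multiple of the degree map `deg_F`
(`Ker deg_F = span_ℝ APrc(F)` by [FrdI] Thm. 6.4 (i) / Dirichlet + class number, and `deg_F` is onto).
[cite: MochizukiFrdI2008, Thm. 6.4 (i) p.115] -/
theorem linearForm_eq_smul_degF_of_principal (φ : ADivisor F →ₗ[ℝ] ℝ)
    (hφ : ∀ f : F, f ≠ 0 → φ (ADivisor.principal f) = 0) : ∃ c : ℝ, φ = c • degF F := by
  classical
  have hker : LinearMap.ker (degF F) ≤ LinearMap.ker φ := by
    rw [← span_APrc_eq_ker_degF, Submodule.span_le]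
    rintro a ⟨f, hf, rfl⟩
    exact LinearMap.mem_ker.mpr (hφ f hf)
  obtain ⟨e, he⟩ := degF_surjective F 1
  refine ⟨φ e, LinearMap.ext fun a => ?_⟩
  have hmem : a - degF F a • e ∈ LinearMap.ker (degF F) := by
    rw [LinearMap.mem_ker, map_sub, map_smul, he, smul_eq_mul, mul_one, sub_self]
  have h0 := hker hmem
  rw [LinearMap.mem_ker, map_sub, map_smul, smul_eq_mul, sub_eq_zero] at h0
  rw [LinearMap.smul_apply, smul_eq_mul, h0, mul_comm]

/-- **Rigidity of product-formula exponents** (general number field; the `F = ℚ` case is the abc-iut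
cell's `CandJoshi33.PF_forces_constant`): if a family of real exponents `γ : 𝕍(F) → ℝ` satisfies the
re-weighted product formula `Σ_v γ_v·ADiv(f)_v·deg_F(v) = 0` — i.e. `∏_v ‖f‖_v^{γ_v} = 1` — for every
`f ∈ F^×`, then `γ` is CONSTANT on `𝕍(F)` (archimedean and nonarchimedean places alike). In particular
no "place-selective" re-normalisation of the standard absolute values preserves the product formula.
[cite: MochizukiFrdI2008, Thm. 6.4 (i) p.115] -/
theorem exponents_const_of_weighted_productFormula (γ : Place F → ℝ)
    (h : ∀ f : F, f ≠ 0 → (ADivisor.principal f).sum (fun v c => c * (γ v * degWeight F v)) = 0)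
    (v w : Place F) : γ v = γ w := by
  classical
  -- the `γ`-re-weighted degree form `φ_γ : Σ c_v·v ↦ Σ_v c_v·γ_v·deg_F(v)`; on `ADiv(f)` it is `−log ∏_v ‖f‖_v^{γ_v}`
  let φ : ADivisor F →ₗ[ℝ] ℝ := Finsupp.linearCombination ℝ fun v => γ v * degWeight F v
  have hφ_apply : ∀ a : ADivisor F, φ a = a.sum (fun v c => c * (γ v * degWeight F v)) := fun a => by
    simp [φ, Finsupp.linearCombination_apply, Finsupp.sum, smul_eq_mul]
  have hφ : ∀ f : F, f ≠ 0 → φ (ADivisor.principal f) = 0 := fun f hf => by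
    rw [hφ_apply]; exact h f hf
  obtain ⟨c, hc⟩ := linearForm_eq_smul_degF_of_principal φ hφ
  have key : ∀ u : Place F, γ u = c := fun u => by
    have hdeg : degF F (ADivisor.of u 1) = degWeight F u := by
      simp [degF, Finsupp.linearCombination_single]
    have hof : φ (ADivisor.of u 1) = γ u * degWeight F u := by
      simp [φ, Finsupp.linearCombination_single]
    have h1 : φ (ADivisor.of u 1) = (c • degF F) (ADivisor.of u 1) := by rw [hc]
    rw [hof, LinearMap.smul_apply, smul_eq_mul, hdeg] at h1
    exact mul_right_cancel₀ (degWeight_pos F u).ne' h1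
  rw [key v, key w]

end Literature.IUT.LogVolume

end
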